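import Mathlib
import Summits.NavierStokesRegularity.NavierStokesRegularity.Theorems.SubOnsagerCeilingGapFamily
import HarnessLib

/-!
# The design «d45» as a `GapFamily.Params` datum (parametric route), with its admissibility
(helper file for crux stmt-NavierStokesRegularity-27057 `SubOnsagerCeiling.ForwardTailCeilingKP`, `--supports … --as helper`;
LEAD SOC g11, line «kp-shell-barrier»)

`d45θ` = the coefficients of the face family «d45» (census v13 §K.5; the same numbers as `SubOnsagerCeilingGapFaces`) as a
`GapFamily.Params` literal, `d45θ_adm : d45θ.Adm` (decided by `norm_num`) and `d45θ_a0 : d45θ.a0 ≠ 0`. This is the worked instance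
of the PARAMETRIC route (`SubOnsagerCeilingGapFamily{,Kernel}`): the certificates `SubOnsagerCeilingGapFamilyCertB*` and the slice
assembly `SubOnsagerCeilingGapFamilySliceB` re-derive RUNG 10's slice B from this datum with no design-specific Lean besides this file.
HONEST FRAMING: MODEL-lattice plumbing; nothing here bears on Navier–Stokes regularity; 27057 stays OPEN.
[cite: BarbatoMorandinRomito2011, §2 Lemma 2.1]
-/

noncomputable section

-- the sub-problem namespace `NavierStokesRegularity.NavierStokesRegularity` is the tree's layout (D-0017)
set_option linter.dupNamespace false

namespace Summit.NavierStokesRegularity.NavierStokesRegularity.Theorems.VirtualFloor.GapFamily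

/-- The design «d45» (census v13 §K.5) as a `Params` literal. [folklore] -/
def d45θ : Params := { kap := (9/20), eps := (1/1000), a0 := (77/25), a1 := (26/25), a2 := (1/50), ac := (1911/500), b1 := 2, bc := (2793/1000), fc := (-69433/12500), f0 := (9999/10000), f1 := (279359/50000), f2 := (164977/100000), f00 := (581/12500), f11 := (95763/100000), f22 := (428987/100000), f01 := (4683/100000), f02 := (-1473/1250), f12 := (-150393/25000), gc := (-3477/1000), g0 := (1/2), g1 := 5, g2 := (-109/20), g00 := (4/25), g11 := 0, g22 := (231/50), g01 := 0, g02 := (-1/25), g12 := 0 }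

/-- «d45» is admissible. [folklore] -/
theorem d45θ_adm : d45θ.Adm := by
  constructor <;> norm_num [d45θ, Params.pos]

/-- Its corner-cap A leading coefficient is non-zero. [folklore] -/
theorem d45θ_a0 : d45θ.a0 ≠ 0 := by norm_num [d45θ]

end Summit.NavierStokesRegularity.NavierStokesRegularity.Theorems.VirtualFloor.GapFamily

end
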